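import Mathlib
import Summits.NavierStokesRegularity.NavierStokesRegularity.Theorems.TaoLadderRungTwoFlatHopAprioriGraded
import HarnessLib

/-!
# FINITE-TIME CONTINUITY OF EXACT GRADED FLOWS IN THE SUP NORM, A-PRIORI-FREE (the analytic input L3 of the CAPTURE hops of the
  tube frame `H(n)`, `n < N₀`)
  (helper for the K_A♭ parent item stmt-NavierStokesRegularity-22987 `FlatGapCertificatesV2`, child 2A `GradedAdiabaticWakeA` of route
  TaoLadderRungTwoFlat; cell harvest/h2-tao-ladder, p1 g25; LADDER §47.5 L3 (finite-time continuity), §50 (`TubeStepCapture`))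

`MirrorPulse.gauge_deviation_of_gradedFlows` (renormalised-frame gauge Grönwall) bounds the gauge distance of two exact graded
certificate flows `S`, `W` on `[0, τ]` CONDITIONALLY on a clock-weighted sup bound `c_k|S_k|, c_k|W_k| ≤ M̃` of BOTH flows. At a capture
hop only the REFERENCE `W` (the datum flow between two checkpoints) comes with such a bound; the premise flow `S` is known only to start
close to it. This module removes the hypothesis on `S` by continuous induction (`Bootstrap.Icc_induction`): while `c|S| ≤ M_W + 1` the
Grönwall bound keeps the deviation `≤ B·e^{Lτ} ≤ ½`, hence `c|S| ≤ M_W + ½`; the format's a-priori clause (4.5) makes the set of shells on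
which `c_k|S_k| ≤ M_W + 1` is not automatic FINITE (`R54.clockW_abs_eventually_le` ahead, `clockW_abs_le_behind` behind), so the induction
runs on a finite sup, which is continuous. The gauge is `ω_k = max(1, c_k)` (`c_k = (1+ε₀)^{5k/2}`): plain sup distance at and behind the
front, clock-weighted ahead; `ω/c` is window-regular with `Λ = (1+ε₀)^{5/2}`.

* `clockW_abs_le_behind` — (4.5) behind: `∃ k₀ ≤ 0, ∀ k < k₀, c_k|S_{ik}(s)| ≤ M_c` on `[0, τ]` (`0 < ε₀`, `0 < M_c`);
* `isWindowRegular_supGauge` — `k ↦ max(1, c_k)/c_k` is window-regular with constant `(1+ε₀)^{5/2}`;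
* `sup_deviation_of_gradedFlows` — **for two exact graded flows on `[0, τ]` with `c_k|W_k| ≤ M_W`, `max(1,c_k)|S₀ − W₀|_k ≤ B` over all
  shells and `B·e^{Lτ} ≤ ½`, `L = 2‖α̃‖₁(M_W + 1)(1+ε₀)^{5/2}`: `max(1,c_k)|S_k(s) − W_k(s)| ≤ B·e^{Ls}` on `[0, τ]`** — in particular plain
  sup-closeness `|S − W|(s) ≤ B·e^{Ls}` at every site (the capture ball of the next hop).

HONEST FRAMING: a finite-time estimate about MODEL-lattice certificate flows (graded mirror table on `S♭`, `m = 2`); the reference bound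
and the smallness `B·e^{Lτ} ≤ ½` are HYPOTHESES; nothing certified; no item closed; nothing about the Navier–Stokes equations.
-/

noncomputable section

-- the sub-problem namespace repeats the summit name by design (D-0017)
set_option linter.dupNamespace false

namespace Summit.NavierStokesRegularity.NavierStokesRegularity.Theorems.HopTube

open Set Finset Literature.Analysis.FluidPDE Literature.Analysis.FluidPDE.TaoCascade MirrorPulse RenormFrame QuadPolar
  GappedFrontRobustOn

/-- **(4.5) behind: the clock-weighted amplitude of a certificate flow is below any positive level deep behind**, uniformly on
`[0, τ]`: `∃ k₀ ≤ 0, ∀ k < k₀, c_k·|S_{ik}(s)| ≤ M_c` (`0 < ε₀`, `0 < M_c`; the amplitudes are bounded and the clocks vanish).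
[cite: Tao2016AveragedNS, §4 Lemma 4.1 (4.5); route TaoLadderRungTwoFlat, in-hop a-priori (finite reduction behind)] -/
theorem clockW_abs_le_behind {𝕊 : Finset (ℤ × ℤ × ℤ)} {τ ε₀ : ℝ}
    {α : Fin 2 → Fin 2 → Fin 2 → ℤ × ℤ × ℤ → ℝ} {κ₁ κ₂ : ℝ} {S₀ F₀ B₀ : Fin 2 → ℤ → ℝ}
    {S F : Fin 2 → ℤ → ℝ → ℝ} (h : PseudoFlowOnShift 𝕊 τ ε₀ α κ₁ κ₂ S₀ F₀ B₀ S F) (hε₀ : 0 < ε₀)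
    {Mc : ℝ} (hMc : 0 < Mc) :
    ∃ k₀ : ℤ, k₀ ≤ 0 ∧ ∀ k : ℤ, k < k₀ → ∀ (i : Fin 2), ∀ s ∈ Icc 0 τ, clockW ε₀ k * |S i k s| ≤ Mc := by
  obtain ⟨M, hM⟩ := h.apriori_S
  obtain ⟨N, hN⟩ := exists_nat_gt (M / (Mc * ε₀))
  refine ⟨-(N : ℤ), by omega, fun k hk i s hs => ?_⟩
  have hq : 0 < 1 + ε₀ := by linarith
  have h1 := hM s hs i k
  have hp : 0 < (1 + ε₀) ^ ((10 : ℝ) * k) := Real.rpow_pos_of_pos hq _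
  have hM0 : 0 ≤ M := le_trans (by positivity) h1
  have h2 : |S i k s| ≤ M := by nlinarith [abs_nonneg (S i k s)]
  have hkR : (k : ℝ) ≤ -(N : ℝ) := by exact_mod_cast hk.le
  have hk0 : (k : ℝ) ≤ 0 := hkR.trans (by simp)
  -- clockW_k ≤ (1+ε₀)^{k} ≤ (1+ε₀)^{−N} ≤ 1/(1 + Nε₀)
  have h3 : clockW ε₀ k ≤ (1 + ε₀) ^ (-(N : ℝ)) := by
    unfold clockW
    exact Real.rpow_le_rpow_of_exponent_le (by linarith) (by linarith)
  have hbern : 1 + (N : ℝ) * ε₀ ≤ (1 + ε₀) ^ (N : ℝ) := by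
    have := one_add_mul_le_pow (by linarith : (-2 : ℝ) ≤ ε₀) N
    rw [Real.rpow_natCast]; linarith
  have hpos : 0 < 1 + (N : ℝ) * ε₀ := by positivity
  have h4 : (1 + ε₀) ^ (-(N : ℝ)) ≤ (1 + (N : ℝ) * ε₀)⁻¹ := by
    rw [Real.rpow_neg hq.le]
    exact inv_anti₀ hpos hbern
  have h5 : (1 + (N : ℝ) * ε₀)⁻¹ * M ≤ Mc := by
    rw [inv_mul_le_iff₀ hpos]
    have h7 : M / (Mc * ε₀) < N := hN
    rw [div_lt_iff₀ (by positivity)] at h7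
    nlinarith
  calc clockW ε₀ k * |S i k s| ≤ (1 + (N : ℝ) * ε₀)⁻¹ * M :=
        mul_le_mul (h3.trans h4) h2 (abs_nonneg _) (inv_pos.mpr hpos).le
    _ ≤ Mc := h5

/-- **The sup gauge is admissible**: `k ↦ max(1, c_k)/c_k` is window-regular with constant `(1+ε₀)^{5/2}` (`0 ≤ ε₀`).
[cite: Tao2016AveragedNS, §4 (4.8) (the clocks); route TaoLadderRungTwoFlat, renormalised-frame gauge Grönwall] -/
theorem isWindowRegular_supGauge {ε₀ : ℝ} (hε₀ : 0 ≤ ε₀) :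
    IsWindowRegular (fun (_ : Fin 2) k => max 1 (clockW ε₀ k) / clockW ε₀ k) ((1 + ε₀) ^ ((5 : ℝ) / 2)) := by
  have hε' : (-1 : ℝ) < ε₀ := by linarith
  have hc : ∀ k, 0 < clockW ε₀ k := clockW_pos hε'
  have hΛ1 : 1 ≤ (1 + ε₀) ^ ((5 : ℝ) / 2) := Real.one_le_rpow (by linarith) (by norm_num)
  refine ⟨fun _ n => div_pos (lt_of_lt_of_le one_pos (le_max_left _ _)) (hc n), hΛ1, fun _ _ n k hk => ?_⟩
  have hck : clockW ε₀ k ≤ (1 + ε₀) ^ ((5 : ℝ) / 2) * clockW ε₀ n := by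
    unfold clockW
    rw [← Real.rpow_add (by linarith)]
    apply Real.rpow_le_rpow_of_exponent_le (by linarith)
    have : (k : ℝ) ≤ n + 1 := by exact_mod_cast hk.2
    linarith
  have h1 : 1 ≤ max 1 (clockW ε₀ k) / clockW ε₀ k := by
    rw [le_div_iff₀ (hc k), one_mul]; exact le_max_right _ _
  show max 1 (clockW ε₀ n) / clockW ε₀ n ≤ (1 + ε₀) ^ ((5 : ℝ) / 2) * (max 1 (clockW ε₀ k) / clockW ε₀ k)
  rw [div_le_iff₀ (hc n)]
  apply max_le
  · have hx : 1 / clockW ε₀ k ≤ max 1 (clockW ε₀ k) / clockW ε₀ k :=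
      div_le_div_of_nonneg_right (le_max_left _ _) (hc k).le
    have h2 : 1 ≤ (1 + ε₀) ^ ((5 : ℝ) / 2) * (1 / clockW ε₀ k) * clockW ε₀ n := by
      rw [mul_one_div, div_mul_eq_mul_div, one_le_div (hc k)]; exact hck
    have hΛ0 : 0 ≤ (1 + ε₀) ^ ((5 : ℝ) / 2) := zero_le_one.trans hΛ1
    exact h2.trans (mul_le_mul_of_nonneg_right (mul_le_mul_of_nonneg_left hx hΛ0) (hc n).le)
  · exact le_mul_of_one_le_left (hc n).le (one_le_mul_of_one_le_of_one_le hΛ1 h1)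

/-- **FINITE-TIME CONTINUITY OF EXACT GRADED FLOWS, A-PRIORI-FREE.** Two exact graded certificate flows `W` (reference) and `S` on
`[0, τ]`; `c_k|W_{ik}| ≤ M_W` on the window; `max(1, c_k)·|S₀ − W₀|_{ik} ≤ B` over all shells; `B·e^{Lτ} ≤ ½` with
`L = 2‖α̃‖₁·(M_W + 1)·(1+ε₀)^{5/2}`. Then `max(1, c_k)·|S_{ik}(s) − W_{ik}(s)| ≤ B·e^{Ls}` for every site and every `s ∈ [0, τ]`.
[cite: Tao2016AveragedNS, §4 Lemma 4.1 (4.5), (4.8), §5 (continuity argument); route TaoLadderRungTwoFlat, capture hops (cell LADDER §47.5 L3, §50)] -/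
theorem sup_deviation_of_gradedFlows {ε ε₀ τ : ℝ} {W₀ S₀ : Fin 2 → ℤ → ℝ} {W FW S FS : Fin 2 → ℤ → ℝ → ℝ}
    (hW : PseudoFlowOnShift shiftSetFlat τ ε₀ (mirrorTable ε ε) 0 0 W₀ (fun i k => (1 / 2) * W₀ i k ^ 2)
      (fun _ _ => 0) W FW)
    (hS : PseudoFlowOnShift shiftSetFlat τ ε₀ (mirrorTable ε ε) 0 0 S₀ (fun i k => (1 / 2) * S₀ i k ^ 2)
      (fun _ _ => 0) S FS)
    (hε₀ : 0 < ε₀) (hτ : 0 ≤ τ) {MW B : ℝ} (hMW : 0 ≤ MW)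
    (hWb : ∀ i k, ∀ t ∈ Icc 0 τ, clockW ε₀ k * |W i k t| ≤ MW)
    (hB : ∀ i k, max 1 (clockW ε₀ k) * |S₀ i k - W₀ i k| ≤ B)
    (hsmall : B * Real.exp (2 * tableAbsSum shiftSetFlat (renormTable ε₀ (mirrorTable ε ε)) * (MW + 1)
      * (1 + ε₀) ^ ((5 : ℝ) / 2) * τ) ≤ 1 / 2) :
    ∀ (i : Fin 2) (k : ℤ), ∀ s ∈ Icc 0 τ, max 1 (clockW ε₀ k) * |S i k s - W i k s|
      ≤ B * Real.exp (2 * tableAbsSum shiftSetFlat (renormTable ε₀ (mirrorTable ε ε)) * (MW + 1)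
          * (1 + ε₀) ^ ((5 : ℝ) / 2) * s) := by
  have hε' : (-1 : ℝ) < ε₀ := by linarith
  have hc : ∀ k, 0 < clockW ε₀ k := clockW_pos hε'
  have hreg := isWindowRegular_supGauge hε₀.le
  have hT0 : 0 ≤ tableAbsSum shiftSetFlat (renormTable ε₀ (mirrorTable ε ε)) := tableAbsSum_nonneg _ _
  have hL0 : 0 ≤ 2 * tableAbsSum shiftSetFlat (renormTable ε₀ (mirrorTable ε ε)) * (MW + 1) * (1 + ε₀) ^ ((5 : ℝ) / 2) := by
    have : 0 ≤ (1 + ε₀) ^ ((5 : ℝ) / 2) := Real.rpow_nonneg (by linarith) _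
    positivity
  have hB0 : 0 ≤ B := le_trans (mul_nonneg (zero_le_one.trans (le_max_left _ _)) (abs_nonneg _)) (hB 0 0)
  have hexpτ : ∀ t, t ≤ τ →
      B * Real.exp (2 * tableAbsSum shiftSetFlat (renormTable ε₀ (mirrorTable ε ε)) * (MW + 1) * (1 + ε₀) ^ ((5 : ℝ) / 2) * t)
        ≤ 1 / 2 := fun t ht =>
    (mul_le_mul_of_nonneg_left (Real.exp_le_exp.mpr (mul_le_mul_of_nonneg_left ht hL0)) hB0).trans hsmall
  -- the finite set of shells where `c|S| ≤ MW + 1` is not automatic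
  have hMc : 0 < MW + 1 := by linarith
  obtain ⟨k₀, hk₀0, hk₀⟩ := R54.clockW_abs_eventually_le hS hε₀ hMc
  obtain ⟨kl, hkl0, hkl⟩ := clockW_abs_le_behind hS hε₀ hMc
  set I : Finset (Fin 2 × ℤ) := Finset.univ ×ˢ Finset.Icc kl k₀ with hI
  have hIne : I.Nonempty := ⟨(0, 0), by simp only [hI, Finset.mem_product, Finset.mem_univ, Finset.mem_Icc, true_and]; omega⟩
  set f : ℝ → ℝ := fun t => I.sup' hIne (fun p => clockW ε₀ p.2 * |S p.1 p.2 t|) with hf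
  have hScont : ∀ i k, ContinuousOn (S i k) (Icc 0 τ) := fun i k => continuousOn_of_pseudoFlowOnShift hS i k
  have hfcont : ContinuousOn f (Icc 0 τ) :=
    ContinuousOn.finset_sup'_apply hIne fun p _ => continuousOn_const.mul (hScont p.1 p.2).abs
  -- "f ≤ MW + 1 on [0, t]" ⇒ every shell obeys `c|S| ≤ MW + 1` on `[0, t]`
  have hall : ∀ t, t ≤ τ → (∀ s ∈ Icc 0 t, f s ≤ MW + 1) →
      ∀ (i : Fin 2) (k : ℤ), ∀ s ∈ Icc 0 t, clockW ε₀ k * |S i k s| ≤ MW + 1 := by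
    intro t htτ hft i k s hs
    have hsτ : s ∈ Icc 0 τ := ⟨hs.1, hs.2.trans htτ⟩
    rcases lt_or_ge k₀ k with hk | hk
    · exact hk₀ k hk i s hsτ
    rcases lt_or_ge k kl with hk' | hk'
    · exact hkl k hk' i s hsτ
    · have hp : (i, k) ∈ I := by
        simp only [hI, Finset.mem_product, Finset.mem_univ, Finset.mem_Icc, true_and]; exact ⟨hk', hk⟩
      exact (Finset.le_sup' (fun p : Fin 2 × ℤ => clockW ε₀ p.2 * |S p.1 p.2 s|) hp).trans (hft s hs)
  -- Grönwall on an initial segment `[0, t]` under the background bound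
  have hgron : ∀ t, 0 < t → t ≤ τ → (∀ (i : Fin 2) (k : ℤ), ∀ s ∈ Icc 0 t, clockW ε₀ k * |S i k s| ≤ MW + 1) →
      ∀ (i : Fin 2) (k : ℤ), ∀ s ∈ Icc 0 t, max 1 (clockW ε₀ k) * |S i k s - W i k s|
        ≤ B * Real.exp (2 * tableAbsSum shiftSetFlat (renormTable ε₀ (mirrorTable ε ε)) * (MW + 1)
            * (1 + ε₀) ^ ((5 : ℝ) / 2) * s) := by
    intro t ht htτ hSb i k s hs
    have hS' := pseudoFlowOnShift_mono hS ht htτ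
    have hW' := pseudoFlowOnShift_mono hW ht htτ
    have hWb' : ∀ (i : Fin 2) (k : ℤ), ∀ s ∈ Icc 0 t, clockW ε₀ k * |W i k s| ≤ MW + 1 := fun i k s hs =>
      (hWb i k s ⟨hs.1, hs.2.trans htτ⟩).trans (by linarith)
    exact gauge_deviation_of_gradedFlows hW' hS' hε₀.le (ω := fun (_ : Fin 2) k => max 1 (clockW ε₀ k)) hreg hSb hWb' hB i k hs
  -- the initial clock-weighted bound of `S`
  have hinit : ∀ (i : Fin 2) (k : ℤ), clockW ε₀ k * |S i k 0| ≤ MW + 1 / 2 := by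
    intro i k
    have hw0 := hWb i k 0 ⟨le_rfl, hτ⟩
    rw [hW.init_S] at hw0
    rw [hS.init_S]
    have htri := abs_sub_abs_le_abs_sub (S₀ i k) (W₀ i k)
    have h1 : clockW ε₀ k * |S₀ i k - W₀ i k| ≤ B :=
      (mul_le_mul_of_nonneg_right (le_max_right 1 _) (abs_nonneg _)).trans (hB i k)
    have hB2 : B ≤ 1 / 2 := by
      have := hexpτ 0 hτ
      rwa [mul_zero, Real.exp_zero, mul_one] at this
    nlinarith [hc k]
  -- continuous induction on the finite sup
  have hboot := Bootstrap.Icc_induction (f := f) (a := MW + 1) (b := MW + 1 / 2) hτ hfcont (by linarith)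
    (Finset.sup'_le hIne _ fun p _ => hinit p.1 p.2) (by
      intro t ht hft
      refine Finset.sup'_le hIne _ fun p _ => ?_
      rcases eq_or_lt_of_le ht.1 with h0 | htpos
      · rw [← h0]; exact hinit p.1 p.2
      · have hSb := hall t ht.2 hft
        have hd := hgron t htpos ht.2 hSb p.1 p.2 t ⟨ht.1, le_rfl⟩
        have hw := hWb p.1 p.2 t ht
        have h2 : clockW ε₀ p.2 * |S p.1 p.2 t - W p.1 p.2 t| ≤ 1 / 2 :=
          ((mul_le_mul_of_nonneg_right (le_max_right 1 _) (abs_nonneg _)).trans hd).trans (hexpτ t ht.2)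
        have htri := abs_sub_abs_le_abs_sub (S p.1 p.2 t) (W p.1 p.2 t)
        nlinarith [hc p.2])
  -- conclusion: the background bound holds on `[0, τ]`, so Grönwall applies on the whole window
  intro i k s hs
  rcases eq_or_lt_of_le hτ with h0 | hτpos
  · have hs0 : s = 0 := le_antisymm (h0 ▸ hs.2) hs.1
    subst hs0
    rw [hS.init_S, hW.init_S, mul_zero, Real.exp_zero, mul_one]
    exact hB i k
  · exact hgron τ hτpos le_rfl (hall τ le_rfl fun s hs => (hboot s hs).trans (by linarith)) i k s hs

end Summit.NavierStokesRegularity.NavierStokesRegularity.Theorems.HopTube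

end
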